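import Mathlib
import Summits.Ventures.PercRepro2.HCov
import Summits.Ventures.PercRepro2.HCovSwap
import Summits.Ventures.PercRepro2.GcSkelReductionMin
import Summits.Ventures.PercRepro2.GcSkelReductionZ
import Summits.Ventures.PercRepro2.GcSkelSwap
import Summits.Ventures.PercRepro2.GcSkelNorm
import Summits.Ventures.PercRepro2.GcHatConn
import Summits.Ventures.PercRepro2.GcSkelReductionHat
import Summits.Ventures.PercRepro2.GcInterior
import Summits.Ventures.PercRepro2.GcInteriorDo
import Summits.Ventures.PercRepro2.GcRational

/-!
# The class of record with no hat: the root swap and the WLOG normalisations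
(blind cell PercRepro2, typer-1 g56)

A hat is a hat for the swapped roots (`isHatAt_swap`, `hasHat_swap`), so the class of record with
no hat is symmetric in the roots (**`wredMinHAZH_swap`**), and the two normalisations of
`GcSkelNorm.lean` apply to it: **`HCov_all_iff_HCovWRedMinHAZHo_int_all`** (`o ↔ a₂` in
`G − {a₁, a₃}` without loss of generality — there `P(PD, o ∈ C₂) > 0` and `marginC > 0` at
interior weights, `PD_oH_pos_of_conn` / `marginC_pos_of_conn`) and
**`HCov_all_iff_HCovWRedMinHAZHg_int_all`** (`0 ≤ gap` without loss of generality), both over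
`ℝ ↔ ℚ`. Standard axioms.
-/

namespace Summit.Ventures.PercRepro2

open CovForm RECM SepPair

namespace WRed

section Swap

variable {V : Type*} {E : Type*}

/-- A hat for the swapped roots (the root edges exchanged). -/
lemma isHatAt_swap {ends : E → Sym2 V} {u a₁ a₂ w : V} {e₁ e₂ e₃ : E}
    (h : Hat.IsHatAt ends u a₁ a₂ w e₁ e₂ e₃) : Hat.IsHatAt ends u a₂ a₁ w e₂ e₁ e₃ where
  h1 := h.h2
  h2 := h.h1
  h3 := h.h3
  e12 := h.e12.symm
  e13 := h.e23
  e23 := h.e13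
  ua1 := h.ua2
  ua2 := h.ua1
  uw := h.uw
  wa1 := h.wa2
  wa2 := h.wa1
  other := fun g g2 g1 g3 hg => h.other g g1 g2 g3 hg

variable [Fintype E] [DecidableEq E] [DecidableEq V]

omit [Fintype E] [DecidableEq E] [DecidableEq V] in
/-- `HasHat` is symmetric in the roots. -/
lemma hasHat_swap {ends : E → Sym2 V} {o a₁ a₂ a₃ b : V} (h : HasHat ends o a₁ a₂ a₃ b) :
    HasHat ends o a₂ a₁ a₃ b := by
  obtain ⟨u, w, e₁, e₂, e₃, hu, hhat⟩ := h
  exact ⟨u, w, e₂, e₁, e₃, unmarked_swap hu, isHatAt_swap hhat⟩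

omit [DecidableEq E] in
/-- **THE CLASS OF RECORD WITH NO HAT IS SYMMETRIC IN THE ROOTS.** -/
theorem wredMinHAZH_swap {ends : E → Sym2 V} {o a₁ a₂ a₃ b : V}
    (h : WReducedMinHAZH ends o a₁ a₂ a₃ b) : WReducedMinHAZH ends o a₂ a₁ a₃ b where
  toWReducedMinHAZ := wredMinHAZ_swap h.toWReducedMinHAZ
  noHat := fun hh => h.noHat (hasHat_swap hh)

end Swap

section Closures

variable (R : Type*) [Field R] [LinearOrder R] [IsStrictOrderedRing R]

/-- **(HCOV) on the class of record with no hat at interior weights, `o ↔ a₂` in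
`G − {a₁, a₃}`.** -/
def HCovWRedMinHAZHo_int_all : Prop :=
  ∀ (V E : Type) [Fintype V] [DecidableEq V] [Fintype E] [DecidableEq E]
    (ends : E → Sym2 V) (p : E → R), IsIntVec p →
    ∀ o a₁ a₂ a₃ b : V, a₁ ≠ a₂ → a₁ ≠ a₃ → a₂ ≠ a₃ → o ≠ a₁ → o ≠ a₂ → o ≠ a₃ → o ≠ b →
      b ≠ a₁ → b ≠ a₂ → b ≠ a₃ → WReducedMinHAZH ends o a₁ a₂ a₃ b →
      Conn ends (sepConfig ends {a₁, a₃}) o a₂ → HCov p ends o a₁ a₂ a₃ b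

/-- **(HCOV) on the class of record with no hat at interior weights, nonnegative gap.** -/
def HCovWRedMinHAZHg_int_all : Prop :=
  ∀ (V E : Type) [Fintype V] [DecidableEq V] [Fintype E] [DecidableEq E]
    (ends : E → Sym2 V) (p : E → R), IsIntVec p →
    ∀ o a₁ a₂ a₃ b : V, a₁ ≠ a₂ → a₁ ≠ a₃ → a₂ ≠ a₃ → o ≠ a₁ → o ≠ a₂ → o ≠ a₃ → o ≠ b →
      b ≠ a₁ → b ≠ a₂ → b ≠ a₃ → WReducedMinHAZH ends o a₁ a₂ a₃ b →
      0 ≤ gap p ends a₁ a₂ b → HCov p ends o a₁ a₂ a₃ b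

end Closures

section Main

variable {R : Type*} [Field R] [LinearOrder R] [IsStrictOrderedRing R]

omit [IsStrictOrderedRing R] in
/-- The normalised closure gives the closure. -/
theorem HCovWRedMinHAZH_int_all_of_o (h : HCovWRedMinHAZHo_int_all R) :
    HCovWRedMinHAZH_int_all R := by
  intro V E _ _ _ _ ends p hp o a₁ a₂ a₃ b h12 h13 h23 ho1 ho2 ho3 hob hb1 hb2 hb3 hred
  have hI : WReducedI ends o a₁ a₂ a₃ b :=
    (wredT_iff_wredMin.2 hred.toWReducedMin).toWReducedI
  rcases conn_sepConfig_pair_of_wredI hI h12 h13 h23 ho1 ho2 ho3 hob hb1 hb2 hb3 with hc | hc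
  · exact (HCov_swap p ends o a₁ a₂ a₃ b).1
      (h V E ends p hp o a₂ a₁ a₃ b h12.symm h23 h13 ho2 ho1 ho3 hob hb2 hb1 hb3
        (wredMinHAZH_swap hred) hc)
  · exact h V E ends p hp o a₁ a₂ a₃ b h12 h13 h23 ho1 ho2 ho3 hob hb1 hb2 hb3 hred hc

/-- **THE CRUX ON THE CLASS OF RECORD WITH NO HAT, `o ↔ a₂` OFF `{a₁, a₃}` WITHOUT LOSS OF
GENERALITY.** -/
theorem HCov_all_iff_HCovWRedMinHAZHo_int_all : HCov_all R ↔ HCovWRedMinHAZHo_int_all R :=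
  ⟨fun h V E _ _ _ _ ends p hp o a₁ a₂ a₃ b h12 h13 h23 ho1 ho2 ho3 hob hb1 hb2 hb3 _ _ =>
      h V E ends p hp.isProbVec o a₁ a₂ a₃ b h12 h13 h23 ho1 ho2 ho3 hob hb1 hb2 hb3,
    fun h => HCov_all_of_HCovWRedMinHAZH_int_all (HCovWRedMinHAZH_int_all_of_o h)⟩

/-- The gap-normalised closure gives the closure. -/
theorem HCovWRedMinHAZH_int_all_of_g (h : HCovWRedMinHAZHg_int_all R) :
    HCovWRedMinHAZH_int_all R := by
  intro V E _ _ _ _ ends p hp o a₁ a₂ a₃ b h12 h13 h23 ho1 ho2 ho3 hob hb1 hb2 hb3 hred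
  by_cases hg : 0 ≤ gap p ends a₁ a₂ b
  · exact h V E ends p hp o a₁ a₂ a₃ b h12 h13 h23 ho1 ho2 ho3 hob hb1 hb2 hb3 hred hg
  · have hg' : 0 ≤ gap p ends a₂ a₁ b := by
      rw [gap_swap]
      exact neg_nonneg.2 (le_of_lt (not_le.1 hg))
    exact (HCov_swap p ends o a₁ a₂ a₃ b).1
      (h V E ends p hp o a₂ a₁ a₃ b h12.symm h23 h13 ho2 ho1 ho3 hob hb2 hb1 hb3
        (wredMinHAZH_swap hred) hg')

/-- **THE CRUX ON THE CLASS OF RECORD WITH NO HAT AND A NONNEGATIVE LABELLING GAP.** -/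
theorem HCov_all_iff_HCovWRedMinHAZHg_int_all : HCov_all R ↔ HCovWRedMinHAZHg_int_all R :=
  ⟨fun h V E _ _ _ _ ends p hp o a₁ a₂ a₃ b h12 h13 h23 ho1 ho2 ho3 hob hb1 hb2 hb3 _ _ =>
      h V E ends p hp.isProbVec o a₁ a₂ a₃ b h12 h13 h23 ho1 ho2 ho3 hob hb1 hb2 hb3,
    fun h => HCov_all_of_HCovWRedMinHAZH_int_all (HCovWRedMinHAZH_int_all_of_g h)⟩

end Main

section Real

/-- The structural normalisation over the rationals, on the class of record with no hat. -/
theorem HCov_all_real_iff_HCovWRedMinHAZHo_int_all_rat :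
    HCov_all ℝ ↔ HCovWRedMinHAZHo_int_all ℚ :=
  HCov_all_real_iff_rat.trans (HCov_all_iff_HCovWRedMinHAZHo_int_all (R := ℚ))

/-- The gap normalisation over the rationals, on the class of record with no hat. -/
theorem HCov_all_real_iff_HCovWRedMinHAZHg_int_all_rat :
    HCov_all ℝ ↔ HCovWRedMinHAZHg_int_all ℚ :=
  HCov_all_real_iff_rat.trans (HCov_all_iff_HCovWRedMinHAZHg_int_all (R := ℚ))

end Real

end WRed

end Summit.Ventures.PercRepro2
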